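import Summits.CriticalPhenomena.PercolationContinuityZ3.Theorems.SahiTP2Kernel
import Summits.CriticalPhenomena.PercolationContinuityZ3.Theorems.SahiLiebSahiContinuumRealKernel

/-!
# Every TP₂ law on the unit square is Sahi-positive of every order — no density, no continuity, no semicontinuity

Companion of `SahiTP2Kernel.lean` (cell `prim-sahi`, typer seat, generation 10; `--supports stmt-CriticalPhenomena-4575`).

`SahiTP2Kernel.exists_cisKernel` gives every finite TP₂ measure on `ℝ × ℝ` with bounded second coordinate an
everywhere stochastically increasing Markov-kernel version of its conditional law, so the generation-9 theorem
`msahiE_nonneg_of_cis_real` (CIS laws on the plane) applies: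

* `msahiE_nonneg_of_isTP2Cut` — every TP₂ probability law on `ℝ²` carried by a horizontal strip `ℝ × [y₀, y₁]` is
  Sahi-positive of every order for bounded measurable monotone families;
* `msahiE_nonneg_of_isTP2Cut_unitSquare` — transporting along the inclusion `[0,1]² → ℝ²` and the retraction
  `projIcc`: **every TP₂ probability law `μ` on `[0,1]²` satisfies Sahi's inequalities `E_n(f_0,…,f_{n-1}) ≥ 0` of
  EVERY order for ALL measurable nonnegative monotone (increasing) families**; `…_antitone` — the same for decreasing
  families (TP₂ is invariant under the central symmetry `(x,y) ↦ (1-x,1-y)`, `IsTP2Cut.map_symm`).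

This removes the semicontinuity hypothesis of `SahiTwoDimSemicontinuous.msahiE_nonneg_of_semicontinuous`
(generation 6) for TP₂ laws (that file's "cell-FKG" hypothesis — FKG lattice condition for the cell weights of every
uniform grid — implies and is implied by `IsTP2Cut`; the identification is the business of `SahiTP2CellFKG.lean`).
So the two-dimensional continuum case of Sahi's programme now reads: every probability measure on `[0,1]²` whose
rectangle masses are TP₂ — Lebesgue measure [LiebSahi2021, Thm. 3.7], products, MTP₂ densities, CIS laws, and every
SINGULAR TP₂ law — is Sahi-positive of every order, with no hypothesis on the measure or on the monotone family beyond
measurability.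

No sorries, no new axioms.  [cite: LiebSahi2021, Thm. 3.7] (the Lebesgue case behind the standard construction).
-/

noncomputable section

namespace Summit.CriticalPhenomena.PercolationContinuityZ3.Theorems.SahiTP2

open MeasureTheory ProbabilityTheory Set Filter Topology Function
open Literature.Combinatorics.Sahi2008
open scoped ENNReal unitInterval

/-! ## The plane, bounded second coordinate -/

/-- In a probability space an a.e. window is nonempty. [folklore] -/
theorem le_of_ae_mem_Icc {ρ : Measure (ℝ × ℝ)} [IsProbabilityMeasure ρ] {y₀ y₁ : ℝ}
    (hY : ∀ᵐ p ∂ρ, p.2 ∈ Icc y₀ y₁) : y₀ ≤ y₁ := by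
  obtain ⟨p, hp⟩ := hY.exists
  exact hp.1.trans hp.2

/-- **Every TP₂ probability law on `ℝ²` with bounded second coordinate is Sahi-positive of every order** for
bounded measurable monotone families: `E_n(f_0,…,f_{n-1}) ≥ 0`. [this work] -/
theorem msahiE_nonneg_of_isTP2Cut (ρ : Measure (ℝ × ℝ)) [IsProbabilityMeasure ρ] (hρ : IsTP2Cut ρ)
    {y₀ y₁ : ℝ} (hY : ∀ᵐ p ∂ρ, p.2 ∈ Icc y₀ y₁) (n : ℕ) (f : Fin n → ℝ × ℝ → ℝ)
    (hfm : ∀ i, Measurable (f i)) (hf0 : ∀ i p, 0 ≤ f i p) {M : ℝ} (hfM : ∀ i p, f i p ≤ M)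
    (hmono : ∀ i, Monotone (f i)) : 0 ≤ msahiE ρ n f := by
  obtain ⟨κ, hκM, hdis, hκ⟩ := exists_cisKernel hρ (le_of_ae_mem_Icc hY) hY
  exact msahiE_nonneg_of_cis_real ρ κ hdis hκ n f hfm hf0 hfM hmono


/-! ## The unit square -/

/-- The trace of a real closed interval on `[0,1]`, when nonempty, is the closed interval of `[0,1]` with the
projected endpoints. [folklore] -/
theorem preimage_val_Icc_eq {a b : ℝ} (hne : ((Subtype.val : I → ℝ) ⁻¹' Icc a b).Nonempty) :
    ((Subtype.val : I → ℝ) ⁻¹' Icc a b) = Icc (projIcc 0 1 zero_le_one a) (projIcc 0 1 zero_le_one b) := by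
  obtain ⟨x, hx⟩ := hne
  have ha1 : a ≤ 1 := hx.1.trans x.2.2
  have hb0 : 0 ≤ b := x.2.1.trans hx.2
  have hpa : (projIcc 0 1 zero_le_one a : ℝ) = max 0 a := by
    rw [coe_projIcc, min_eq_right ha1]
  have hpb : (projIcc 0 1 zero_le_one b : ℝ) = min 1 b := by
    rw [coe_projIcc, max_eq_right (le_min zero_le_one hb0)]
  ext y
  simp only [mem_preimage, mem_Icc]
  rw [← Subtype.coe_le_coe, ← Subtype.coe_le_coe, hpa, hpb, max_le_iff, le_min_iff]
  exact ⟨fun h => ⟨⟨y.2.1, h.1⟩, ⟨y.2.2, h.2⟩⟩, fun h => ⟨h.1.2, h.2.2⟩⟩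

/-- **TP₂ passes from `[0,1]²` to the plane** along the inclusion. [this work] -/
theorem IsTP2Cut.map_val (μ : Measure (I × I)) (hμ : IsTP2Cut μ) :
    IsTP2Cut (μ.map (Prod.map Subtype.val Subtype.val : I × I → ℝ × ℝ)) := by
  have hem : Measurable (Prod.map Subtype.val Subtype.val : I × I → ℝ × ℝ) :=
    measurable_subtype_coe.prodMap measurable_subtype_coe
  intro a₁ b₁ a₂ b₂ hlt L hL hLm
  have hpre : ∀ (s T : Set ℝ), MeasurableSet s → MeasurableSet T →
      μ.map (Prod.map Subtype.val Subtype.val) (s ×ˢ T) =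
        μ ((Subtype.val ⁻¹' s) ×ˢ (Subtype.val ⁻¹' T)) := by
    intro s T hs hT
    rw [Measure.map_apply hem (hs.prod hT), ← preimage_prod_map_prod]
  rw [hpre _ _ measurableSet_Icc hLm.compl, hpre _ _ measurableSet_Icc hLm, hpre _ _ measurableSet_Icc hLm,
    hpre _ _ measurableSet_Icc hLm.compl, preimage_compl]
  have hL'low : IsLowerSet ((Subtype.val : I → ℝ) ⁻¹' L) := fun x y hyx hx =>
    hL (show (y : ℝ) ≤ x from hyx) hx
  have hL'm : MeasurableSet ((Subtype.val : I → ℝ) ⁻¹' L) := measurable_subtype_coe hLm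
  by_cases h₁ : ((Subtype.val : I → ℝ) ⁻¹' Icc a₁ b₁).Nonempty
  · by_cases h₂ : ((Subtype.val : I → ℝ) ⁻¹' Icc a₂ b₂).Nonempty
    · obtain ⟨x₁, hx₁⟩ := h₁
      obtain ⟨x₂, hx₂⟩ := h₂
      have hb₁ : 0 ≤ b₁ := x₁.2.1.trans hx₁.2
      have ha₂ : a₂ ≤ 1 := hx₂.1.trans x₂.2.2
      rw [preimage_val_Icc_eq ⟨x₁, hx₁⟩, preimage_val_Icc_eq ⟨x₂, hx₂⟩]
      refine hμ ?_ hL'low hL'm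
      rw [← Subtype.coe_lt_coe, coe_projIcc, coe_projIcc]
      have hb₁1 : b₁ ≤ 1 := hlt.le.trans ha₂
      have ha₂0 : 0 ≤ a₂ := hb₁.trans hlt.le
      rw [min_eq_right hb₁1, max_eq_right hb₁, min_eq_right ha₂, max_eq_right ha₂0]
      exact hlt
    · rw [not_nonempty_iff_eq_empty.1 h₂]
      simp
  · rw [not_nonempty_iff_eq_empty.1 h₁]
    simp

/-- **Every TP₂ probability law on the unit square is Sahi-positive of every order**, for all measurable
nonnegative monotone (increasing) families — no density, continuity or semicontinuity hypothesis.  (Monotone families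
on `[0,1]²` are automatically bounded by their value at `(1,1)`.) [this work]
[cite: LiebSahi2021, Thm. 3.7] (the Lebesgue case, which drives the proof through the standard construction) -/
theorem msahiE_nonneg_of_isTP2Cut_unitSquare (μ : Measure (I × I)) [IsProbabilityMeasure μ] (hμ : IsTP2Cut μ)
    (n : ℕ) (f : Fin n → I × I → ℝ) (hfm : ∀ i, Measurable (f i)) (hf0 : ∀ i p, 0 ≤ f i p)
    (hmono : ∀ i, Monotone (f i)) : 0 ≤ msahiE μ n f := by
  classical
  set e : I × I → ℝ × ℝ := Prod.map Subtype.val Subtype.val with he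
  set r : ℝ × ℝ → I × I := Prod.map (projIcc 0 1 zero_le_one) (projIcc 0 1 zero_le_one) with hr
  have hem : Measurable e := measurable_subtype_coe.prodMap measurable_subtype_coe
  have hrm : Measurable r := continuous_projIcc.measurable.prodMap continuous_projIcc.measurable
  have hre : r ∘ e = id := by
    funext p
    simp [hr, he, Prod.map, projIcc_val]
  set ρ : Measure (ℝ × ℝ) := μ.map e with hρ
  haveI : IsProbabilityMeasure ρ := Measure.isProbabilityMeasure_map hem.aemeasurable
  have hY : ∀ᵐ p ∂ρ, p.2 ∈ Icc (0 : ℝ) 1 := by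
    rw [hρ, ae_map_iff hem.aemeasurable (measurableSet_Icc.preimage measurable_snd)]
    exact ae_of_all _ fun p => p.2.2
  have hmp : MeasurePreserving r ρ μ := by
    refine ⟨hrm, ?_⟩
    rw [hρ, Measure.map_map hrm hem, hre, Measure.map_id]
  rw [← msahiE_comp_measurePreserving_of_measurable hmp n f hfm]
  have hle1 : ∀ x : I, x ≤ 1 := fun x => Subtype.coe_le_coe.1 (by rw [Set.Icc.coe_one]; exact x.2.2)
  have htop : ∀ p : ℝ × ℝ, r p ≤ ((1 : I), (1 : I)) := fun p => ⟨hle1 _, hle1 _⟩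
  have hrmono : Monotone r := (monotone_projIcc zero_le_one).prodMap (monotone_projIcc zero_le_one)
  refine msahiE_nonneg_of_isTP2Cut ρ (IsTP2Cut.map_val μ hμ) hY n (fun i => f i ∘ r)
    (fun i => (hfm i).comp hrm) (fun i p => hf0 i _) (M := ∑ i, f i ((1 : I), (1 : I))) (fun i p => ?_)
    (fun i p q hpq => hmono i (hrmono hpq))
  calc (f i ∘ r) p = f i (r p) := rfl
    _ ≤ f i ((1 : I), (1 : I)) := hmono i (htop p)
    _ ≤ ∑ j, f j ((1 : I), (1 : I)) :=
        Finset.single_le_sum (f := fun j => f j ((1 : I), (1 : I))) (fun j _ => hf0 j _) (Finset.mem_univ i)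

/-- **TP₂ is invariant under the central symmetry** `(x,y) ↦ (1-x, 1-y)` of the unit square. [this work] -/
theorem IsTP2Cut.map_symm (μ : Measure (I × I)) (hμ : IsTP2Cut μ) :
    IsTP2Cut (μ.map (Prod.map unitInterval.symm unitInterval.symm)) := by
  have hsm : Measurable (Prod.map unitInterval.symm unitInterval.symm : I × I → I × I) :=
    unitInterval.continuous_symm.measurable.prodMap unitInterval.continuous_symm.measurable
  intro a₁ b₁ a₂ b₂ hlt L hL hLm
  have hpre : ∀ (s T : Set I), MeasurableSet s → MeasurableSet T →
      μ.map (Prod.map unitInterval.symm unitInterval.symm) (s ×ˢ T) =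
        μ ((unitInterval.symm ⁻¹' s) ×ˢ (unitInterval.symm ⁻¹' T)) := by
    intro s T hs hT
    rw [Measure.map_apply hsm (hs.prod hT), ← preimage_prod_map_prod]
  have hIcc : ∀ a b : I, unitInterval.symm ⁻¹' Icc a b = Icc (unitInterval.symm b) (unitInterval.symm a) := by
    intro a b
    ext x
    simp only [mem_preimage, mem_Icc]
    constructor
    · rintro ⟨h1, h2⟩
      refine ⟨?_, ?_⟩
      · have := unitInterval.symm_le_symm.2 h2
        rwa [unitInterval.symm_symm] at this
      · have := unitInterval.symm_le_symm.2 h1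
        rwa [unitInterval.symm_symm] at this
    · rintro ⟨h1, h2⟩
      refine ⟨?_, ?_⟩
      · have := unitInterval.symm_le_symm.2 h2
        rwa [unitInterval.symm_symm] at this
      · have := unitInterval.symm_le_symm.2 h1
        rwa [unitInterval.symm_symm] at this
  rw [hpre _ _ measurableSet_Icc hLm.compl, hpre _ _ measurableSet_Icc hLm, hpre _ _ measurableSet_Icc hLm,
    hpre _ _ measurableSet_Icc hLm.compl, hIcc, hIcc, preimage_compl]
  set U : Set I := unitInterval.symm ⁻¹' L with hU
  -- `U` is an upper set, so `Uᶜ` is a measurable lower set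
  have hUc : IsLowerSet Uᶜ := by
    intro x y hyx hx hy
    exact hx (hL (unitInterval.symm_le_symm.2 hyx) hy)
  have hUm : MeasurableSet U := unitInterval.continuous_symm.measurable hLm
  have hlt' : unitInterval.symm a₂ < unitInterval.symm b₁ := unitInterval.symm_lt_symm.2 hlt
  have key := hμ hlt' hUc hUm.compl (a₁ := unitInterval.symm b₂) (b₂ := unitInterval.symm a₁)
  rw [compl_compl] at key
  calc μ (Icc (unitInterval.symm b₁) (unitInterval.symm a₁) ×ˢ Uᶜ) *
        μ (Icc (unitInterval.symm b₂) (unitInterval.symm a₂) ×ˢ U)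
      = μ (Icc (unitInterval.symm b₂) (unitInterval.symm a₂) ×ˢ U) *
          μ (Icc (unitInterval.symm b₁) (unitInterval.symm a₁) ×ˢ Uᶜ) := mul_comm _ _
    _ ≤ μ (Icc (unitInterval.symm b₂) (unitInterval.symm a₂) ×ˢ Uᶜ) *
          μ (Icc (unitInterval.symm b₁) (unitInterval.symm a₁) ×ˢ U) := key
    _ = μ (Icc (unitInterval.symm b₁) (unitInterval.symm a₁) ×ˢ U) *
          μ (Icc (unitInterval.symm b₂) (unitInterval.symm a₂) ×ˢ Uᶜ) := mul_comm _ _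

/-- **Every TP₂ probability law on the unit square is Sahi-positive of every order, decreasing form** (the printed
orientation of [LiebSahi2021]): all measurable nonnegative monotone decreasing families. [this work] -/
theorem msahiE_nonneg_of_isTP2Cut_unitSquare_antitone (μ : Measure (I × I)) [IsProbabilityMeasure μ]
    (hμ : IsTP2Cut μ) (n : ℕ) (f : Fin n → I × I → ℝ) (hfm : ∀ i, Measurable (f i)) (hf0 : ∀ i p, 0 ≤ f i p)
    (hanti : ∀ i, Antitone (f i)) : 0 ≤ msahiE μ n f := by
  set sy : I × I → I × I := Prod.map unitInterval.symm unitInterval.symm with hsy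
  have hsm : Measurable sy :=
    unitInterval.continuous_symm.measurable.prodMap unitInterval.continuous_symm.measurable
  have hss : sy ∘ sy = id := by
    funext p
    simp [hsy, Prod.map]
  haveI : IsProbabilityMeasure (μ.map sy) := Measure.isProbabilityMeasure_map hsm.aemeasurable
  have hmp : MeasurePreserving sy (μ.map sy) μ := by
    refine ⟨hsm, ?_⟩
    rw [Measure.map_map hsm hsm, hss, Measure.map_id]
  rw [← msahiE_comp_measurePreserving_of_measurable hmp n f hfm]
  refine msahiE_nonneg_of_isTP2Cut_unitSquare (μ.map sy) (IsTP2Cut.map_symm μ hμ) n (fun i => f i ∘ sy)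
    (fun i => (hfm i).comp hsm) (fun i p => hf0 i _) fun i p q hpq => hanti i ?_
  exact ⟨unitInterval.symm_le_symm.2 hpq.1, unitInterval.symm_le_symm.2 hpq.2⟩

end Summit.CriticalPhenomena.PercolationContinuityZ3.Theorems.SahiTP2
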